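import Mathlib
import Summits.Ventures.HodgeRepro2.T5ResidueConjugate
import Summits.Ventures.HodgeRepro2.T5AdicCompletionSummary
import Summits.Ventures.HodgeRepro2.T5AdicCompletionRamified

/-!
# The unramified integral basis and the three numbers of N5.15.2 (A15) on MATHLIB'S COMPLETIONS

`Kv := v.adicCompletion K ⊆ Lw := w.adicCompletion L` (number fields, `w ∣ v`, the canonical
continuous algebra of `T5AdicCompletionMap`), `O_Kv ⊆ O_Lw` their valuation rings.  Every
structural hypothesis of `T5ResidueConjugate` is now DISCHARGED from Mathlib and the earlier
files of this seat:

* `Module.Finite O_Kv O_Lw` — INSTANCE: Mathlib's `IsIntegralClosure.finite` on top of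
  `T5AdicCompletionIntegral`'s `IsIntegralClosure O_Lw O_Kv Lw` (every remaining instance —
  `IsFractionRing O_Kv Kv`, `Module.Finite Kv Lw`, `Algebra.IsSeparable Kv Lw`,
  `IsIntegrallyClosed O_Kv`, `IsNoetherianRing O_Kv` — is found by instance search);
* `card_residueField_eq_pow_inertiaDeg'` (abstract DVR pair): `|k_S| = |k_R|^f`
  (`Ideal.inertiaDeg'_algebraMap` + `Module.natCard_eq_pow_finrank`);
* `card_residueField_of_quadratic_inert`: at an INERT quadratic place (`[Lw : Kv] = 2`, a uniformiser
  `ϖ` of `O_Kv` staying a uniformiser of `O_Lw`) `|k(O_Lw)| = |k(O_Kv)|² = N(v)²`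
  (`T5AdicCompletionInert.inertiaDeg'_eq_two_of_quadratic_inert`);
* `card_residueField_of_quadratic_ramified`: at a RAMIFIED quadratic place `|k(O_Lw)| = N(v)` (`f = 1`,
  `T5AdicCompletionRamified`) — the «residue fields of order `q` on both sides» hypothesis of
  `T5RamifiedCharacterCount`;
* `two_le_card_residueField`: `N(v) ≥ 2`;
* the injectivity `O_Kv → O_Lw` and `IsLocalHom` (`T5ContinuousValuationExtension`).

What stays a HYPOTHESIS (the datum identification, not a theorem): the conjugation `σ` of the
quadratic extension restricted to `O_Lw` — a ring involution fixing `O_Kv` and NOTHING ELSE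
(`hfix`).  With it: `exists_integralBasis` (θ with `θ − σ θ` a unit and `O_Lw = O_Kv ⊕ O_Kv θ`),
and `[E¹ : E¹ ∩ U^n] = (N(v)+1) N(v)^{n−1}`, `|E¹/(E¹ ∩ U²)| = (N(v)+1) N(v)`,
`|G/G¹| = N(v) + 1`, `|G¹| = N(v)` — the sentence of N5.15.2 (A15) / N5.T3 l. 450 on Mathlib's
objects with `q_w = N(v)`.

Declaration per README §8(d): «uses an L-value-free non-vanishing device: NO».
-/

namespace Summit.Ventures.HodgeRepro2.T5AdicCompletionIntegralBasis

open IsDedekindDomain HeightOneSpectrum IsLocalRing T5FiltrationHilbert90 T5PrincipalUnitFiltration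

section Abstract

variable {R S : Type*} [CommRing R] [CommRing S] [Algebra R S] [IsDomain R] [IsDomain S]
  [IsDiscreteValuationRing R] [IsDiscreteValuationRing S] [Module.Finite R S]

/-- `|k_S| = |k_R|^f` for a finite extension of DVRs, `f = inertiaDeg'` of the uniformiser ideals
`(ϖ) ⊆ R`, `(π) ⊆ S` (`(π)` lying over `(ϖ)`). -/
theorem card_residueField_eq_pow_inertiaDeg'_of_irreducible {ϖ : R} (hϖ : Irreducible ϖ) {π : S}
    (hπ : Irreducible π) [(Ideal.span {π}).LiesOver (Ideal.span {ϖ})] :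
    Nat.card (ResidueField S) =
      Nat.card (ResidueField R) ^ (Ideal.span {ϖ}).inertiaDeg' (Ideal.span {π}) := by
  haveI : (Ideal.span {ϖ}).IsMaximal := T5AdicCompletionInert.span_isMaximal hϖ
  letI : Field (R ⧸ Ideal.span {ϖ}) := Ideal.Quotient.field _
  rw [Ideal.inertiaDeg'_algebraMap]
  have e1 : ResidueField R ≃+* R ⧸ Ideal.span {ϖ} := Ideal.quotEquivOfEq hϖ.maximalIdeal_eq
  have e2 : ResidueField S ≃+* S ⧸ Ideal.span {π} := Ideal.quotEquivOfEq hπ.maximalIdeal_eq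
  rw [Nat.card_congr e1.toEquiv, Nat.card_congr e2.toEquiv]
  exact Module.natCard_eq_pow_finrank (K := R ⧸ Ideal.span {ϖ}) (V := S ⧸ Ideal.span {π})

/-- The inert shape: `π = algebraMap ϖ`. -/
theorem card_residueField_eq_pow_inertiaDeg' {ϖ : R} (hϖ : Irreducible ϖ)
    (hϖS : Irreducible (algebraMap R S ϖ))
    [(Ideal.span {algebraMap R S ϖ}).LiesOver (Ideal.span {ϖ})] :
    Nat.card (ResidueField S) =
      Nat.card (ResidueField R) ^ (Ideal.span {ϖ}).inertiaDeg' (Ideal.span {algebraMap R S ϖ}) :=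
  card_residueField_eq_pow_inertiaDeg'_of_irreducible hϖ hϖS

end Abstract

section Completions

variable {K : Type*} [Field K] [NumberField K] (v : HeightOneSpectrum (NumberField.RingOfIntegers K))
  {L : Type*} [Field L] [NumberField L] [Algebra K L]
  (w : HeightOneSpectrum (NumberField.RingOfIntegers L)) [w.asIdeal.LiesOver v.asIdeal]

/-- `O_Lw` is a FINITE `O_Kv`-module (Mathlib's `IsIntegralClosure.finite` on
`T5AdicCompletionIntegral`'s `IsIntegralClosure O_Lw O_Kv Lw`). -/
instance finite_adicCompletionIntegers :
    Module.Finite (adicCompletionIntegers K v) (adicCompletionIntegers L w) :=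
  IsIntegralClosure.finite (adicCompletionIntegers K v) (adicCompletion K v) (adicCompletion L w)
    (adicCompletionIntegers L w)

/-- `N(v) = |k(O_Kv)| ≥ 2`. -/
theorem two_le_card_residueField : 2 ≤ Nat.card (ResidueField (adicCompletionIntegers K v)) := by
  have := Finite.one_lt_card_iff_nontrivial.2
    (inferInstance : Nontrivial (ResidueField (adicCompletionIntegers K v)))
  omega

/-- At an INERT quadratic place, `|k(O_Lw)| = |k(O_Kv)|²`. -/
theorem card_residueField_of_quadratic_inert
    (h2 : Module.finrank (adicCompletion K v) (adicCompletion L w) = 2)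
    {ϖ : adicCompletionIntegers K v} (hϖ : Irreducible ϖ)
    (hϖS : Irreducible (algebraMap (adicCompletionIntegers K v) (adicCompletionIntegers L w) ϖ)) :
    Nat.card (ResidueField (adicCompletionIntegers L w)) =
      Nat.card (ResidueField (adicCompletionIntegers K v)) ^ 2 := by
  haveI := T5AdicCompletionInert.liesOver_span_algebraMap v w hϖ hϖS
  rw [card_residueField_eq_pow_inertiaDeg' hϖ hϖS,
    T5AdicCompletionInert.inertiaDeg'_eq_two_of_quadratic_inert v w h2 hϖ hϖS]

/-- `|k(O_Lw)| = N(v)²` at an inert quadratic place. -/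
theorem card_residueField_eq_absNorm_sq
    (h2 : Module.finrank (adicCompletion K v) (adicCompletion L w) = 2)
    {ϖ : adicCompletionIntegers K v} (hϖ : Irreducible ϖ)
    (hϖS : Irreducible (algebraMap (adicCompletionIntegers K v) (adicCompletionIntegers L w) ϖ)) :
    Nat.card (ResidueField (adicCompletionIntegers L w)) = Ideal.absNorm v.asIdeal ^ 2 := by
  rw [card_residueField_of_quadratic_inert v w h2 hϖ hϖS,
    T5AdicCompletionResidueField.card_residueField]

/-- At a RAMIFIED quadratic place (`ϖ` irreducible in `O_Kv`, NOT irreducible in `O_Lw`) the residue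
fields have the same cardinality `N(v)` (`f = 1`, `T5AdicCompletionRamified`). -/
theorem card_residueField_of_quadratic_ramified
    (h2 : Module.finrank (adicCompletion K v) (adicCompletion L w) = 2)
    {ϖ : adicCompletionIntegers K v} (hϖ : Irreducible ϖ)
    (hϖS : ¬ Irreducible (algebraMap (adicCompletionIntegers K v) (adicCompletionIntegers L w) ϖ)) :
    Nat.card (ResidueField (adicCompletionIntegers L w)) =
      Nat.card (ResidueField (adicCompletionIntegers K v)) := by
  obtain ⟨π, hπ⟩ := T5AdicCompletionConductor.exists_irreducible (K := L) w
  obtain ⟨u, hu⟩ := T5AdicCompletionRamified.exists_unit_algebraMap_eq_mul_sq v w h2 hϖ hπ hϖS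
  haveI := T5AdicCompletionRamified.liesOver_span_of_dvd hϖ hπ ⟨(u : adicCompletionIntegers L w) * π, by
    rw [hu]; ring⟩
  rw [card_residueField_eq_pow_inertiaDeg'_of_irreducible hϖ hπ,
    T5AdicCompletionRamified.inertiaDeg'_eq_one_of_not_irreducible v w h2 hϖ hπ hϖS, pow_one]

variable (σ : adicCompletionIntegers L w ≃+* adicCompletionIntegers L w)

/-- THE UNRAMIFIED INTEGRAL BASIS on Mathlib's completions: `σ` a ring involution of `O_Lw` fixing
`O_Kv` and nothing else, `[Lw : Kv] = 2`, `ϖ` a common uniformiser ⇒ ∃ θ, `θ − σ θ` a unit and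
`O_Lw = O_Kv ⊕ O_Kv θ`. -/
theorem exists_integralBasis (hσσ : ∀ s, σ (σ s) = s)
    (hfix : ∀ s, σ s = s → ∃ r, s = algebraMap (adicCompletionIntegers K v) _ r)
    (h2 : Module.finrank (adicCompletion K v) (adicCompletion L w) = 2)
    {ϖ : adicCompletionIntegers K v} (hϖ : Irreducible ϖ)
    (hϖS : Irreducible (algebraMap (adicCompletionIntegers K v) (adicCompletionIntegers L w) ϖ)) :
    ∃ θ : adicCompletionIntegers L w, IsUnit (θ - σ θ) ∧
      ∀ s : adicCompletionIntegers L w, ∃ a b : adicCompletionIntegers K v,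
        s = algebraMap _ _ a + algebraMap _ _ b * θ :=
  T5ResidueConjugate.exists_integralBasis σ hσσ hfix hϖ hϖS (two_le_card_residueField v) rfl
    (card_residueField_of_quadratic_inert v w h2 hϖ hϖS)

/-- N5.15.2 (A15) / N5.T3 l. 450 on Mathlib's completions:
`[E¹ : E¹ ∩ U^n] = (N(v)+1) N(v)^{n−1}` (`n ≥ 1`). -/
theorem relIndex_range_inf_higherUnits_eq
    (hσR : ∀ r, σ (algebraMap (adicCompletionIntegers K v) _ r) = algebraMap _ _ r)
    (hσσ : ∀ s, σ (σ s) = s)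
    (hfix : ∀ s, σ s = s → ∃ r, s = algebraMap (adicCompletionIntegers K v) _ r)
    (h2 : Module.finrank (adicCompletion K v) (adicCompletion L w) = 2)
    {ϖ : adicCompletionIntegers K v} (hϖ : Irreducible ϖ)
    (hϖS : Irreducible (algebraMap (adicCompletionIntegers K v) (adicCompletionIntegers L w) ϖ))
    {n : ℕ} (hn : 1 ≤ n) :
    ((MonoidHom.mk' (conjQuot σ) (conjQuot_mul σ)).range ⊓
        higherUnits (algebraMap _ _ ϖ) n).relIndex
        (MonoidHom.mk' (conjQuot σ) (conjQuot_mul σ)).range =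
      (Ideal.absNorm v.asIdeal + 1) * Ideal.absNorm v.asIdeal ^ (n - 1) := by
  rw [← T5AdicCompletionResidueField.card_residueField]
  exact T5ResidueConjugate.relIndex_range_inf_higherUnits_eq σ hσR hσσ hfix
    T5ContinuousValuationExtension.algebraMap_adicCompletionIntegers_injective hϖ hϖS
    (two_le_card_residueField v) rfl (card_residueField_of_quadratic_inert v w h2 hϖ hϖS) hn

/-- `|E¹/(E¹ ∩ U²)| = (N(v)+1) N(v)`. -/
theorem relIndex_range_inf_higherUnits_two
    (hσR : ∀ r, σ (algebraMap (adicCompletionIntegers K v) _ r) = algebraMap _ _ r)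
    (hσσ : ∀ s, σ (σ s) = s)
    (hfix : ∀ s, σ s = s → ∃ r, s = algebraMap (adicCompletionIntegers K v) _ r)
    (h2 : Module.finrank (adicCompletion K v) (adicCompletion L w) = 2)
    {ϖ : adicCompletionIntegers K v} (hϖ : Irreducible ϖ)
    (hϖS : Irreducible (algebraMap (adicCompletionIntegers K v) (adicCompletionIntegers L w) ϖ)) :
    ((MonoidHom.mk' (conjQuot σ) (conjQuot_mul σ)).range ⊓
        higherUnits (algebraMap _ _ ϖ) 2).relIndex
        (MonoidHom.mk' (conjQuot σ) (conjQuot_mul σ)).range =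
      (Ideal.absNorm v.asIdeal + 1) * Ideal.absNorm v.asIdeal := by
  rw [← T5AdicCompletionResidueField.card_residueField]
  exact T5ResidueConjugate.relIndex_range_inf_higherUnits_two σ hσR hσσ hfix
    T5ContinuousValuationExtension.algebraMap_adicCompletionIntegers_injective hϖ hϖS
    (two_le_card_residueField v) rfl (card_residueField_of_quadratic_inert v w h2 hϖ hϖS)

/-- `|G/G¹| = |E¹/(E¹ ∩ U¹)| = N(v) + 1`. -/
theorem relIndex_range_inf_higherUnits_one
    (hσR : ∀ r, σ (algebraMap (adicCompletionIntegers K v) _ r) = algebraMap _ _ r)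
    (hσσ : ∀ s, σ (σ s) = s)
    (hfix : ∀ s, σ s = s → ∃ r, s = algebraMap (adicCompletionIntegers K v) _ r)
    (h2 : Module.finrank (adicCompletion K v) (adicCompletion L w) = 2)
    {ϖ : adicCompletionIntegers K v} (hϖ : Irreducible ϖ)
    (hϖS : Irreducible (algebraMap (adicCompletionIntegers K v) (adicCompletionIntegers L w) ϖ)) :
    ((MonoidHom.mk' (conjQuot σ) (conjQuot_mul σ)).range ⊓
        higherUnits (algebraMap _ _ ϖ) 1).relIndex
        (MonoidHom.mk' (conjQuot σ) (conjQuot_mul σ)).range = Ideal.absNorm v.asIdeal + 1 := by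
  rw [← T5AdicCompletionResidueField.card_residueField]
  exact T5ResidueConjugate.relIndex_range_inf_higherUnits_one σ hσR hσσ hfix
    T5ContinuousValuationExtension.algebraMap_adicCompletionIntegers_injective hϖ hϖS
    (two_le_card_residueField v) rfl (card_residueField_of_quadratic_inert v w h2 hϖ hϖS)

/-- `|G¹| = |(E¹ ∩ U¹)/(E¹ ∩ U²)| = N(v)`. -/
theorem relIndex_inf_two_inf_one
    (hσR : ∀ r, σ (algebraMap (adicCompletionIntegers K v) _ r) = algebraMap _ _ r)
    (hσσ : ∀ s, σ (σ s) = s)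
    (hfix : ∀ s, σ s = s → ∃ r, s = algebraMap (adicCompletionIntegers K v) _ r)
    (h2 : Module.finrank (adicCompletion K v) (adicCompletion L w) = 2)
    {ϖ : adicCompletionIntegers K v} (hϖ : Irreducible ϖ)
    (hϖS : Irreducible (algebraMap (adicCompletionIntegers K v) (adicCompletionIntegers L w) ϖ)) :
    ((MonoidHom.mk' (conjQuot σ) (conjQuot_mul σ)).range ⊓
        higherUnits (algebraMap _ _ ϖ) 2).relIndex
        ((MonoidHom.mk' (conjQuot σ) (conjQuot_mul σ)).range ⊓
          higherUnits (algebraMap _ _ ϖ) 1) = Ideal.absNorm v.asIdeal := by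
  rw [← T5AdicCompletionResidueField.card_residueField]
  exact T5ResidueConjugate.relIndex_inf_two_inf_one σ hσR hσσ hfix
    T5ContinuousValuationExtension.algebraMap_adicCompletionIntegers_injective hϖ hϖS
    (two_le_card_residueField v) rfl (card_residueField_of_quadratic_inert v w h2 hϖ hϖS)

end Completions

end Summit.Ventures.HodgeRepro2.T5AdicCompletionIntegralBasis
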